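import Summits.HodgeConjecture.CorCM.CyclicSexticFaceMonomialAlgebraic
import Summits.HodgeConjecture.CorCM.WeilLinePairsAlgebraic
import Summits.HodgeConjecture.CorCM.AndreProductFormHolds
import HarnessLib

/-!
# COR-CM (cell `pub-hodgecm2`), A1 line — T1 and T2: every `K`-Weil line of an admissible four-slot product over
# a cyclic sextic CM field is algebraic, and every rational `(2,2)` class on a product of CM abelian varieties
# of such a field is algebraic — given Markman's fourfold theorem (mod `hR`, `h₃`)

HONEST FRAMING (cell pub-hodgecm2 / COR-CM, seat b30 gen 11; COUNT-NEUTRAL; CONDITIONAL on the displayed named fact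
`HodgeTheory.Markman2025_weilClasses_algebraic_abelianFourfold` and the cell's displayed binders `hR`, `h₃`).
Steps L6/T1/T2 of `HOME/pub-hodgecm2-lit-andre-3/A1-BLUEPRINT.md`:

* `weilLineClasses_le_algebraicClasses_of_sumTwo` — for four realisations of CM types `Ψ j` of a Galois sextic CM
  field with `Σ_j 1_{Ψ j} ≡ 2` (`SumTwo`), `weilLineClasses A ι 4` is algebraic: by seat b24's `sumTwo_pattern` the
  family is either two complementary pairs — seat p2's `WeilLineMonomial.weilLineClasses_le_algebraicClasses_of_pattern`
  (Lefschetz (1,1), unconditional) — or in pattern (F) — `weilLineClasses_le_algebraicClasses_of_patternF` (Markman).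
* `andre_weilLines_two_of_markman` — the hypothesis `hW` of `AndreProductForm.mem_algebraicClasses_cmTypedProduct` at
  `p = 2` for realisations `(A i, ι i, θ i)` of types `Φ i` of such a field (the twisted slots realise
  `cmTypeMap (e j) (Φ (i j))`, `IsCMTypeRealisation.transport`).
* `mem_algebraicClasses_two_cmTypedProduct_of_markman` — **T2: every rational class of Hodge type `(2,2)` on
  `⨁ A` is algebraic**, by André's theorem in product form (the tree's THEOREM
  `AndreProductForm.mem_algebraicClasses_cmTypedProduct`).

THEOREMS ONLY; no `sorry`; axioms `propext`, `Classical.choice`, `Quot.sound`.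

## References
* [Markman2025SurveySecant] E. Markman, arXiv:2509.23403, Thm. 1.2 (the displayed hypothesis).
* [Andre1992HodgeCM] Y. André, Progr. Math. 102 (1992), Théorème and p. 2.
* [Milne2020HodgeClassesAV] J. S. Milne, *Hodge classes on abelian varieties* (2020), Theorem 1.
-/

noncomputable section

namespace Summit.HodgeConjecture.CorCM.CyclicSextic

open CategoryTheory CategoryTheory.Limits NumberField
open Literature.AlgebraicTopology.SingularHomology
open Literature.AlgebraicGeometry Literature.AlgebraicGeometry.Motives Literature.AlgebraicGeometry.HodgeTheory
open Literature.AlgebraicGeometry.ComplexMultiplication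
open Literature.NumberTheory.ComplexMultiplication (conjGal)
open Literature.NumberTheory.Automorphic.PicardCM (eigenline)
open Literature.NumberTheory.Automorphic.PicardCM.CMCode (cmTypeMap)

variable {K : Type} [Field K] [NumberField K] [IsCMField K] [IsGalois ℚ K]

/-- **T1: the `K`-Weil line of every admissible (`SumTwo`) four-slot product over a Galois sextic CM field is
algebraic, given Markman.** [cite: Markman2025SurveySecant, Thm. 1.2] [cite: Andre1992HodgeCM, p. 2] -/
theorem weilLineClasses_le_algebraicClasses_of_sumTwo
    (hW4 : Markman2025_weilClasses_algebraic_abelianFourfold) (hR : DeligneMilne1982_Thm_6_20_full)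
    (h₃ : Literature.NumberTheory.Automorphic.PicardCM.CMAbelianVarietyRealised)
    (h6 : Module.finrank ℚ K = 6)
    {A : Fin 4 → AbelianVariety ℂ} {ι : ∀ j, 𝓞 K →+* End (A j)}
    {θ : ∀ j, K →+* Module.End ℂ (complexBetti (A j).X 1)} {Ψ : Fin 4 → CMType K}
    (hA : ∀ j, IsCMTypeRealisation (Ψ j) (A j) (ι j) (θ j)) (hΨ : SumTwo Ψ) :
    weilLineClasses A ι (2 * 2) ≤ algebraicClasses (⨁ A).X 2 := by
  obtain ⟨σ, hσ, h3⟩ := exists_generator (K := K) h6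
  rcases sumTwo_pattern σ h6 hσ h3 Ψ hΨ with ⟨j₁, j₂, j₃, hnd, h1, h3'⟩ | ⟨j₀, j₁, j₂, j₃, hnd, h0, -, h2, h4⟩
  · change weilLineClasses A ι 4 ≤ _
    exact WeilLineMonomial.weilLineClasses_le_algebraicClasses_of_pattern hA hnd h1 h3'
  · exact weilLineClasses_le_algebraicClasses_of_patternF hW4 hR h₃ h6 σ hσ h3 hA hnd h0 h2 h4
      ((sumTwo_iff_ncard_eq_two Ψ).1 hΨ)

/-- **The hypothesis `hW` of André's product form at `p = 2`** for realisations of CM types of a Galois sextic CM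
field: every rational `(2,2)` class of the `K`-Weil line of every admissible twisted four-slot product is algebraic
(indeed every class of that Weil line is), given Markman. [cite: Markman2025SurveySecant, Thm. 1.2] [cite: Andre1992HodgeCM, p. 2] -/
theorem andre_weilLines_two_of_markman
    (hW4 : Markman2025_weilClasses_algebraic_abelianFourfold) (hR : DeligneMilne1982_Thm_6_20_full)
    (h₃ : Literature.NumberTheory.Automorphic.PicardCM.CMAbelianVarietyRealised)
    (h6 : Module.finrank ℚ K = 6) {n : ℕ} (A : Fin n → AbelianVariety ℂ) (Φ : Fin n → CMType K)
    (ι : ∀ i, 𝓞 K →+* End (A i)) (θ : ∀ i, K →+* Module.End ℂ (complexBetti (A i).X 1))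
    (hA : ∀ i, IsCMTypeRealisation (Φ i) (A i) (ι i) (θ i)) :
    ∀ (i : Fin (2 * 2) → Fin n) (e : Fin (2 * 2) → (K ≃+* K)),
      Function.Injective (fun j => (i j, e j)) →
      (∀ s : K →+* ℂ, {j : Fin (2 * 2) | s ∈ (cmTypeMap (e j) (Φ (i j))).1}.ncard = 2) →
      ∀ t : complexBetti (⨁ fun j => A (i j)).X (2 * 2), IsRationalClass t →
        IsOfHodgeType (⨁ fun j => A (i j)).dim (⨁ fun j => A (i j)).X (2 * 2) 2 2 t →
        t ∈ weilLineClasses (fun j => A (i j))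
          (fun j => (ι (i j)).comp (RingOfIntegers.mapRingEquiv (e j).symm).toRingHom) (2 * 2) →
        t ∈ algebraicClasses (⨁ fun j => A (i j)).X 2 := by
  intro i e _ hsum t _ _ ht
  have hA' : ∀ j : Fin 4, IsCMTypeRealisation (cmTypeMap (e j) (Φ (i j))) (A (i j))
      ((ι (i j)).comp (RingOfIntegers.mapRingEquiv (e j).symm).toRingHom) ((θ (i j)).comp (e j).symm.toRingHom) :=
    fun j => (hA (i j)).transport (e j)
  have hΨ : SumTwo (fun j : Fin 4 => cmTypeMap (e j) (Φ (i j))) := (sumTwo_iff_ncard_eq_two _).2 hsum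
  exact weilLineClasses_le_algebraicClasses_of_sumTwo hW4 hR h₃ h6 (A := fun j => A (i j)) hA' hΨ ht

/-- **T2: every rational class of Hodge type `(2,2)` on a product `⨁ A` of realisations of CM types of a Galois
sextic CM field is algebraic, given Markman's fourfold theorem** (André's theorem in product form, the tree's
`AndreProductForm.mem_algebraicClasses_cmTypedProduct`, fed with T1). [cite: Andre1992HodgeCM, Théorème and p. 2]
[cite: Milne2020HodgeClassesAV, Theorem 1] [cite: Markman2025SurveySecant, Thm. 1.2] -/
theorem mem_algebraicClasses_two_cmTypedProduct_of_markman
    (hW4 : Markman2025_weilClasses_algebraic_abelianFourfold) (hR : DeligneMilne1982_Thm_6_20_full)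
    (h₃ : Literature.NumberTheory.Automorphic.PicardCM.CMAbelianVarietyRealised)
    (h6 : Module.finrank ℚ K = 6) {n : ℕ} (A : Fin n → AbelianVariety ℂ) (Φ : Fin n → CMType K)
    (ι : ∀ i, 𝓞 K →+* End (A i)) (θ : ∀ i, K →+* Module.End ℂ (complexBetti (A i).X 1))
    (hA : ∀ i, IsCMTypeRealisation (Φ i) (A i) (ι i) (θ i))
    (c : complexBetti (⨁ A).X (2 * 2)) (hcQ : IsRationalClass c)
    (hcH : IsOfHodgeType (⨁ A).dim (⨁ A).X (2 * 2) 2 2 c) :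
    c ∈ algebraicClasses (⨁ A).X 2 :=
  AndreProductForm.mem_algebraicClasses_cmTypedProduct A Φ ι θ hA 2
    (andre_weilLines_two_of_markman hW4 hR h₃ h6 A Φ ι θ hA) c hcQ hcH

end Summit.HodgeConjecture.CorCM.CyclicSextic

end
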